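import Literature.AlgebraicGeometry.AbelianSchemes.DualIsogenyConjCancel
import Literature.AlgebraicGeometry.AbelianSchemes.AbelianSchemeDualIsogenyHom
import HarnessLib

/-!
# The ROOF SQUARE LAW: `(q ≫ d)^*λ″ = λ_A ≫ [N²]` across an isogeny roof `A —q→ B ←c— A″` with quasi-inverse `d` of `c`
# ([MumfordAV1970] §7 Thm. 4, §15 Thm. 1, §23 Thm. 2)

Topic `Literature/AlgebraicGeometry/AbelianSchemes`, namespace `Literature.AlgebraicGeometry.AbelianSchemes.AbelianSchemeOver`.  THEOREMS ONLY (no definition, no named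
fact, no `instance`, no notation, no `sorry`).  Cell `hodgecm-mathlib` (D-0151), P6 «MOD», line L3 (socket `stub_FROB` → `stub_ROOF0`, `--supports stmt-HodgeConjecture-24832`,
count-neutral): organ **(L-a) «UPSTAIRS LAW PACKAGE»** (LA3-p01 (g2) 05:29:28Z ∕ LA3-plan (g2) 05:42:46Z (5) → A-p14 (g37)), GENERIC BRICK: the law
`(q′ ≫ ψ_{Q,y″})^*λ_{y″} = λ_y ≫ [p²]` of the (r3₀-q) road, where `q′ ≫ ψ′ = q ≫ (E⁻¹ ≫ ψ′) =: q ≫ d` and `d` is a two-sided quasi-inverse of the cover leg `c`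
(`c ≫ d = [N]`, `d ≫ c = [N]`).  NO dual pair of the Serre fibre `𝒞_{y″}` is used — only those of `A_y`, `A_{y″}` and the roof middle `B`.  HC_CM is proved only
modulo the printed citations (2 remaining named inputs hLiu418 24832, h413 24833) until rung 0 closes; this file is generic and changes no count.

THE MATHEMATICS.  Base `S` reduced, locally Noetherian; `A, A″, B` abelian `S`-schemes with dual pairs `DA, DA″, DB` (unit pins for `DA″, DB`); homomorphisms
`q : A → B`, `c : A″ → B` (flat, surjective, quasi-compact), `d : B → A″` with `c ≫ d = [N]_{A″}`, `d ≫ c = [N]_B`, `N ≠ 0`; homomorphisms `λ_A, λ″, λ_B` into the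
duals with the ROOF LAWS (r3q) `q^*λ_B = λ_A ≫ [N]` and (r3c) `c^*λ_B = λ″ ≫ [N]` (pull-back `f^*λ := f ≫ λ ≫ f^∨`).  Then
(i) `[N]^*λ″ = λ″ ≫ [N²]` (`[N]^∨ = [N]`, ★ `dualIsogenyOver_mulN`; homomorphisms commute with `[N]`);
(ii) **`d^*λ″ = λ_B ≫ [N]`**: both sides pull back along `c` to `λ″ ≫ [N²]` (`c^*(d^*λ″) = (c ≫ d)^*λ″ = [N]^*λ″`; `c^*(λ_B ≫ [N]) = (c^*λ_B) ≫ [N]`), and `c`∕`c^∨` cancel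
(★ `eq_of_conj_dualIsogenyOver_eq`, the (L-b) row: `c` is an fpqc epimorphism, `c^∨` has the quasi-inverse `d^∨`);
(iii) **`(q ≫ d)^*λ″ = q^*(d^*λ″) = q^*(λ_B ≫ [N]) = (q^*λ_B) ≫ [N] = λ_A ≫ [N²]`**.
(iv) For a RECOGNITION `E : C ≅ B` under `A″` (`ψ ≫ E = c`) and the two-sided cover pair `ψ ≫ ψ′ = [N]_{A″}`, `ψ′ ≫ ψ = [N]_C`, the map `d := E⁻¹ ≫ ψ′` IS such a
quasi-inverse, so `(q′ ≫ ψ′)^*λ″ = λ_A ≫ [N²]` for `q′ := q ≫ E⁻¹` — the upstairs law of the L3 roof at `N = p` ([MumfordAV1970] §23 Thm. 2 bookkeeping).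

* §1 `pow_id_comp_pow_id`, `mulN_comp_lam_comp_dualIsogenyOver_mulN` (`[N]^*λ = λ ≫ [N²]`);
* §2 **`comp_lam_comp_dualIsogenyOver_quasiInverse`** (`d^*λ″ = λ_B ≫ [N]`);
* §3 **`roof_square_law`** (`(q ≫ d)^*λ″ = λ_A ≫ [N²]`);
* §4 `comp_retarget_quasiInverse`, `retarget_quasiInverse_comp` (`c ≫ (E⁻¹ ≫ ψ′) = [N]`, `(E⁻¹ ≫ ψ′) ≫ c = [N]`), **`roof_square_law_of_recognition`**
  (`((q ≫ E⁻¹) ≫ ψ′)^*λ″ = λ_A ≫ [N²]`).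

## References
* [MumfordAV1970] D. Mumford, *Abelian Varieties* (1970), §7 Thm. 4 (p. 72), §8 (iv) (p. 75), §15 Thm. 1 (p. 143), §23 Thm. 2 (p. 231).
* [MumfordFogartyKirwan1994] D. Mumford, J. Fogarty, F. Kirwan, *GIT*, 3rd ed. (1994), Ch. 6 §1 Cor. 6.4 (p. 117), Ch. 6 §2 Def. 6.3 (p. 120).
* [SGA1] A. Grothendieck, *SGA 1*, Exp. VIII Thm. 5.2.
-/

set_option autoImplicit false

noncomputable section

universe u

open CategoryTheory CategoryTheory.Limits AlgebraicGeometry MonoidalCategory CartesianMonoidalCategory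
open scoped MonObj

namespace Literature.AlgebraicGeometry.AbelianSchemes

namespace AbelianSchemeOver

/-! ## §1 `[N]^*λ = λ ≫ [N²]` -/

section MulN

variable {S : Scheme.{u}} {A : AbelianSchemeOver S}

/-- `[a] ≫ [b] = [a·b]` on any group scheme (`f ≫ gⁿ = (f ≫ g)ⁿ`, Mathlib `MonObj.comp_pow`; `pow_mul`).
[cite: MumfordFogartyKirwan1994, Ch. 6 §1 Cor. 6.4 (p. 117)] -/
theorem pow_id_comp_pow_id {G : Over S} [GrpObj G] (a b : ℕ) :
    ((𝟙 G : G ⟶ G) ^ a) ≫ ((𝟙 G : G ⟶ G) ^ b) = (𝟙 G : G ⟶ G) ^ (a * b) := by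
  rw [MonObj.comp_pow, Category.comp_id, ← pow_mul]

/-- `dualIsogenyOver` depends only on the morphism (rewriting under the instance argument).
[cite: MumfordAV1970, §15 Thm. 1 (p. 143)] -/
private theorem dualIsogenyOver_congr₃ {B : AbelianSchemeOver S} {ψ₁ ψ₂ : A.X ⟶ B.X} [h₁ : IsMonHom ψ₁] [h₂ : IsMonHom ψ₂] (h : ψ₁ = ψ₂)
    (D₁ : A.DualPair) (D₂ : B.DualPair) : @DualPair.dualIsogenyOver S A B ψ₁ h₁ D₁ D₂ = @DualPair.dualIsogenyOver S A B ψ₂ h₂ D₁ D₂ := by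
  subst h; rfl

variable [IsReduced S] [IsLocallyNoetherian S] (D : A.DualPair)
  (hD : Nonempty ((Scheme.Modules.pullback (DualPair.unitHatSlice D)).obj D.P ≅ SheafOfModules.unit _))
  (lam : A.X ⟶ D.hat.X) [IsMonHom lam]

include hD in
/-- **`[N]^*λ = λ ≫ [N²]`**: `[N] ≫ λ ≫ [N]^∨ = λ ≫ [N²]` for a homomorphism `λ : A → Â` (`[N]^∨ = [N]_{Â}` ★ `dualIsogenyOver_mulN`; `[N] ≫ λ = λ ≫ [N]`, ★
`comp_pow_id_eq_pow_id_comp`; `[N] ≫ [N] = [N²]`).  The homomorphism instance on `[N]` is arbitrary (a `Prop`).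
[cite: MumfordAV1970, §8 ((iv), p. 75) and §15 Thm. 1 (p. 143)] [cite: MumfordFogartyKirwan1994, Ch. 6 §2 Def. 6.3 (p. 120)] -/
theorem mulN_comp_lam_comp_dualIsogenyOver_mulN (N : ℕ) [hN : IsMonHom ((𝟙 A.X : A.X ⟶ A.X) ^ N)] :
    ((𝟙 A.X : A.X ⟶ A.X) ^ N) ≫ lam ≫ DualPair.dualIsogenyOver ((𝟙 A.X : A.X ⟶ A.X) ^ N) D D = lam ≫ (𝟙 D.hat.X : D.hat.X ⟶ D.hat.X) ^ (N * N) := by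
  haveI : IsCommMonObj A.X := A.isCommMonObj_of_isReduced_base
  haveI : IsMonHom (A.mulN N) := A.isMonHom_mulN N
  rw [dualIsogenyOver_congr₃ (A.mulN_def N).symm D D, D.dualIsogenyOver_mulN hD N, mulN_def, ← Category.assoc,
    ← A.comp_pow_id_eq_pow_id_comp lam N, Category.assoc, pow_id_comp_pow_id]

end MulN

/-! ## §2 The quasi-inverse leg: `d^*λ″ = λ_B ≫ [N]` -/

section Roof

variable {S : Scheme.{u}} [IsReduced S] [IsLocallyNoetherian S] {A A'' B : AbelianSchemeOver S}
  (q : A.X ⟶ B.X) [IsMonHom q] (c : A''.X ⟶ B.X) [IsMonHom c] [Flat c.left] [Surjective c.left] [QuasiCompact c.left]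
  (d : B.X ⟶ A''.X) [IsMonHom d] {N : ℕ} (hN : N ≠ 0)
  (hcd : c ≫ d = (𝟙 A''.X : A''.X ⟶ A''.X) ^ N) (hdc : d ≫ c = (𝟙 B.X : B.X ⟶ B.X) ^ N)
  (DA : A.DualPair) (DA'' : A''.DualPair) (DB : B.DualPair)
  (hDA'' : Nonempty ((Scheme.Modules.pullback (DualPair.unitHatSlice DA'')).obj DA''.P ≅ SheafOfModules.unit _))
  (hDB : Nonempty ((Scheme.Modules.pullback (DualPair.unitHatSlice DB)).obj DB.P ≅ SheafOfModules.unit _))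
  (lamA : A.X ⟶ DA.hat.X) (lamA'' : A''.X ⟶ DA''.hat.X) (lamB : B.X ⟶ DB.hat.X) [IsMonHom lamA''] [IsMonHom lamB]

include hN hcd hdc hDA'' hDB in
omit [IsMonHom q] in
/-- **`d^*λ″ = λ_B ≫ [N]`** for a two-sided quasi-inverse `d` of the cover leg `c` (`c ≫ d = [N]`, `d ≫ c = [N]`, `N ≠ 0`) under the roof law (r3c)
`c^*λ_B = λ″ ≫ [N]`: both sides pull back along `c` to `λ″ ≫ [N²]` — `c^*(d^*λ″) = (c ≫ d)^*λ″ = [N]^*λ″` (★ `dualIsogenyOver_comp`, §1) and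
`c^*(λ_B ≫ [N]) = (c^*λ_B) ≫ [N]` (`c^∨` commutes with `[N]`) — and `c`, `c^∨` cancel (★ `eq_of_conj_dualIsogenyOver_eq`).
[cite: MumfordAV1970, §7 Thm. 4 (p. 72), §15 Thm. 1 (p. 143) and §23 Thm. 2 (p. 231)] [cite: SGA1, Exp. VIII Thm. 5.2] -/
theorem comp_lam_comp_dualIsogenyOver_quasiInverse
    (hc : c ≫ lamB ≫ DualPair.dualIsogenyOver c DA'' DB = lamA'' ≫ DA''.hat.mulN N) :
    d ≫ lamA'' ≫ DualPair.dualIsogenyOver d DB DA'' = lamB ≫ DB.hat.mulN N := by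
  haveI : IsCommMonObj B.X := B.isCommMonObj_of_isReduced_base
  haveI : IsCommMonObj DB.hat.X := DB.hat.isCommMonObj_of_isReduced_base
  haveI := DualPair.isMonHom_dualIsogenyOver d DB DA'' hDA'' hDB
  haveI := DualPair.isMonHom_dualIsogenyOver c DA'' DB hDB hDA''
  haveI : IsMonHom (DB.hat.mulN N) := DB.hat.isMonHom_mulN N
  haveI : IsMonHom ((𝟙 A''.X : A''.X ⟶ A''.X) ^ N) := by rw [← hcd]; infer_instance
  refine eq_of_conj_dualIsogenyOver_eq c d hN hdc DA'' DB hDB _ _ ?_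
  -- `c ≫ (d ≫ λ″ ≫ d^∨) ≫ c^∨ = (c ≫ d) ≫ λ″ ≫ (c ≫ d)^∨ = [N]^*λ″ = λ″ ≫ [N²]`
  have h1 : c ≫ (d ≫ lamA'' ≫ DualPair.dualIsogenyOver d DB DA'') ≫ DualPair.dualIsogenyOver c DA'' DB =
      lamA'' ≫ (𝟙 DA''.hat.X : DA''.hat.X ⟶ DA''.hat.X) ^ (N * N) := by
    rw [← mulN_comp_lam_comp_dualIsogenyOver_mulN DA'' hDA'' lamA'' N, dualIsogenyOver_congr₃ hcd.symm DA'' DA'',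
      DualPair.dualIsogenyOver_comp c d DA'' DB DA'', ← hcd]
    simp only [Category.assoc]
  -- `c ≫ (λ_B ≫ [N]) ≫ c^∨ = (c ≫ λ_B ≫ c^∨) ≫ [N] = λ″ ≫ [N] ≫ [N]`
  have h2 : c ≫ (lamB ≫ DB.hat.mulN N) ≫ DualPair.dualIsogenyOver c DA'' DB = lamA'' ≫ (𝟙 DA''.hat.X : DA''.hat.X ⟶ DA''.hat.X) ^ (N * N) := by
    rw [mulN_def]
    simp only [Category.assoc]
    rw [← DB.hat.comp_pow_id_eq_pow_id_comp (DualPair.dualIsogenyOver c DA'' DB) N]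
    have h3 : c ≫ lamB ≫ DualPair.dualIsogenyOver c DA'' DB ≫ (𝟙 DA''.hat.X : DA''.hat.X ⟶ DA''.hat.X) ^ N =
        (c ≫ lamB ≫ DualPair.dualIsogenyOver c DA'' DB) ≫ (𝟙 DA''.hat.X : DA''.hat.X ⟶ DA''.hat.X) ^ N := by
      simp only [Category.assoc]
    rw [h3, hc, mulN_def, Category.assoc, pow_id_comp_pow_id]
  rw [h1, h2]

/-! ## §3 The roof square law -/

include hN hcd hdc hDA'' hDB in
/-- **THE ROOF SQUARE LAW: `(q ≫ d)^*λ″ = λ_A ≫ [N²]`** across the roof `A —q→ B ←c— A″` with a two-sided quasi-inverse `d` of `c` (`c ≫ d = [N]`, `d ≫ c = [N]`,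
`N ≠ 0`) and the roof laws (r3q) `q^*λ_B = λ_A ≫ [N]`, (r3c) `c^*λ_B = λ″ ≫ [N]`: `(q ≫ d)^*λ″ = q^*(d^*λ″) = q^*(λ_B ≫ [N]) = (q^*λ_B) ≫ [N] = λ_A ≫ [N²]` (§2 and
★ `dualIsogenyOver_comp`; `q^∨` commutes with `[N]`). [cite: MumfordAV1970, §15 Thm. 1 (p. 143) and §23 Thm. 2 (p. 231)] [cite: MumfordFogartyKirwan1994, Ch. 6 §2 Def. 6.3 (p. 120)] -/
theorem roof_square_law (hDA : Nonempty ((Scheme.Modules.pullback (DualPair.unitHatSlice DA)).obj DA.P ≅ SheafOfModules.unit _))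
    (hq : q ≫ lamB ≫ DualPair.dualIsogenyOver q DA DB = lamA ≫ DA.hat.mulN N)
    (hc : c ≫ lamB ≫ DualPair.dualIsogenyOver c DA'' DB = lamA'' ≫ DA''.hat.mulN N) :
    (q ≫ d) ≫ lamA'' ≫ DualPair.dualIsogenyOver (q ≫ d) DA DA'' = lamA ≫ DA.hat.mulN (N * N) := by
  have hd := comp_lam_comp_dualIsogenyOver_quasiInverse c d hN hcd hdc DA'' DB hDA'' hDB lamA'' lamB hc
  haveI := DualPair.isMonHom_dualIsogenyOver q DA DB hDB hDA
  rw [DualPair.dualIsogenyOver_comp q d DA DB DA'']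
  have h1 : (q ≫ d) ≫ lamA'' ≫ DualPair.dualIsogenyOver d DB DA'' ≫ DualPair.dualIsogenyOver q DA DB =
      q ≫ (d ≫ lamA'' ≫ DualPair.dualIsogenyOver d DB DA'') ≫ DualPair.dualIsogenyOver q DA DB := by
    simp only [Category.assoc]
  rw [h1, hd, mulN_def, mulN_def]
  simp only [Category.assoc]
  rw [← DB.hat.comp_pow_id_eq_pow_id_comp (DualPair.dualIsogenyOver q DA DB) N]
  have h3 : q ≫ lamB ≫ DualPair.dualIsogenyOver q DA DB ≫ (𝟙 DA.hat.X : DA.hat.X ⟶ DA.hat.X) ^ N =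
      (q ≫ lamB ≫ DualPair.dualIsogenyOver q DA DB) ≫ (𝟙 DA.hat.X : DA.hat.X ⟶ DA.hat.X) ^ N := by
    simp only [Category.assoc]
  rw [h3, hq, mulN_def, Category.assoc, pow_id_comp_pow_id]

/-! ## §4 The quasi-inverse from a recognition isomorphism `E : C ≅ B` under `A″` and a two-sided cover pair `(ψ, ψ′)` -/

variable {C : AbelianSchemeOver S} (ψ : A''.X ⟶ C.X) [IsMonHom ψ] (ψ' : C.X ⟶ A''.X) [IsMonHom ψ'] (E : C.X ≅ B.X) [IsMonHom E.hom] [IsMonHom E.inv]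

omit [IsReduced S] [IsLocallyNoetherian S] [IsMonHom c] [Flat c.left] [Surjective c.left] [QuasiCompact c.left] [IsMonHom ψ] [IsMonHom ψ']
  [IsMonHom E.hom] [IsMonHom E.inv] in
/-- `c ≫ (E⁻¹ ≫ ψ′) = ψ ≫ ψ′ = [N]_{A″}` when `ψ ≫ E = c`. [cite: MumfordAV1970, §7 Thm. 4 (p. 72)] -/
theorem comp_retarget_quasiInverse (hE : ψ ≫ E.hom = c) (hψψ' : ψ ≫ ψ' = (𝟙 A''.X : A''.X ⟶ A''.X) ^ N) :
    c ≫ (E.inv ≫ ψ') = (𝟙 A''.X : A''.X ⟶ A''.X) ^ N := by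
  rw [← hE, Category.assoc, E.hom_inv_id_assoc, hψψ']

omit [IsReduced S] [IsLocallyNoetherian S] [IsMonHom c] [Flat c.left] [Surjective c.left] [QuasiCompact c.left] [IsMonHom ψ] [IsMonHom ψ']
  [IsMonHom E.hom] in
/-- `(E⁻¹ ≫ ψ′) ≫ c = E⁻¹ ≫ [N]_C ≫ E = [N]_B` when `ψ ≫ E = c` and `ψ′ ≫ ψ = [N]_C` (`E⁻¹` is a homomorphism, so it commutes with `[N]`).
[cite: MumfordAV1970, §7 Thm. 4 (p. 72)] [cite: MumfordFogartyKirwan1994, Ch. 6 §1 Cor. 6.4 (p. 117)] -/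
theorem retarget_quasiInverse_comp (hE : ψ ≫ E.hom = c) (hψ'ψ : ψ' ≫ ψ = (𝟙 C.X : C.X ⟶ C.X) ^ N) :
    (E.inv ≫ ψ') ≫ c = (𝟙 B.X : B.X ⟶ B.X) ^ N := by
  rw [← hE, Category.assoc, ← Category.assoc ψ' ψ, hψ'ψ, ← Category.assoc, B.comp_pow_id_eq_pow_id_comp E.inv N, Category.assoc,
    E.inv_hom_id, Category.comp_id]

include hN hDA'' hDB in
omit [IsMonHom ψ] [IsMonHom E.hom] in
/-- **THE UPSTAIRS LAW OF THE L3 ROOF** — the roof square law for `d := E⁻¹ ≫ ψ′` from a recognition isomorphism `E : C ≅ B` UNDER `A″` (`ψ ≫ E = c`; ★ KER-EQ ∕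
★ `RoofRetargetAlongRecognition`) and a two-sided cover pair `ψ ≫ ψ′ = [N]_{A″}`, `ψ′ ≫ ψ = [N]_C` (★ `serreTranslate_comp_serreTranslateInv` ∕ `serreTranslateInv_comp_serreTranslate`):
**`((q ≫ E⁻¹) ≫ ψ′)^*λ″ = λ_A ≫ [N²]`**, i.e. `(q′ ≫ ψ_{Q,y″})^*λ_{y″} = λ_y ≫ [p²]` at `N = p` — NO dual pair of `C` involved.
[cite: MumfordAV1970, §15 Thm. 1 (p. 143) and §23 Thm. 2 (p. 231)] [cite: MumfordFogartyKirwan1994, Ch. 6 §2 Def. 6.3 (p. 120)] -/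
theorem roof_square_law_of_recognition (hE : ψ ≫ E.hom = c) (hψψ' : ψ ≫ ψ' = (𝟙 A''.X : A''.X ⟶ A''.X) ^ N)
    (hψ'ψ : ψ' ≫ ψ = (𝟙 C.X : C.X ⟶ C.X) ^ N)
    (hDA : Nonempty ((Scheme.Modules.pullback (DualPair.unitHatSlice DA)).obj DA.P ≅ SheafOfModules.unit _))
    (hq : q ≫ lamB ≫ DualPair.dualIsogenyOver q DA DB = lamA ≫ DA.hat.mulN N)
    (hc : c ≫ lamB ≫ DualPair.dualIsogenyOver c DA'' DB = lamA'' ≫ DA''.hat.mulN N) :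
    ((q ≫ E.inv) ≫ ψ') ≫ lamA'' ≫ DualPair.dualIsogenyOver ((q ≫ E.inv) ≫ ψ') DA DA'' = lamA ≫ DA.hat.mulN (N * N) := by
  have h := roof_square_law q c (E.inv ≫ ψ') hN (comp_retarget_quasiInverse c ψ ψ' E hE hψψ') (retarget_quasiInverse_comp c ψ ψ' E hE hψ'ψ)
    DA DA'' DB hDA'' hDB lamA lamA'' lamB hDA hq hc
  rw [dualIsogenyOver_congr₃ (Category.assoc q E.inv ψ') DA DA'', Category.assoc]
  exact h

end Roof

end AbelianSchemeOver

end Literature.AlgebraicGeometry.AbelianSchemes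

end
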